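import Summits.BirchSwinnertonDyer.BirchSwinnertonDyer.Theorems.EdixhovenFibreFiveSevenStarredOptimalManinUnitFiveSevenAssemblyAtBarOfRangeAt
import Summits.BirchSwinnertonDyer.BirchSwinnertonDyer.Theorems.EdixhovenFibreFiveSevenStarredOptimalManinUnitFiveSevenCellsOfSL2NeronValuesBar
import Summits.BirchSwinnertonDyer.BirchSwinnertonDyer.Theorems.EdixhovenFibreFiveSevenStarredOptimalManinUnitFiveSevenRecTowerAtBridge
import HarnessLib

/-!
# K★ `StarredOptimalManinUnitFiveSeven` ⟸ {P1-bar, Kato's explicit reciprocity law [REC-tower] AT THE K★ CELLS' CYCLOTOMIC TOWERS}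
# (route `EdixhovenFibreFiveSeven`, crux K★ stmt-BirchSwinnertonDyer-22226, line `kato-lever`; seat `bsd-line-edix-p1` g29, LEAD)

HONEST FRAMING. TOOL theorems only (no definition, no named fact, no `sorry`; file-local instance keys on `ℚ_v` byte-identical to
`…SemiLocalIntegralityPinAt` l.164–169, needed only to STATE the displayed hypotheses); nothing is closed or booked; K★ stays OPEN;
BSD is NOT proved by any of this. Last file of the SEAM re-key chain `…TowerRangeAt` → `…SemiLocalIntegralityOfRangeAt` →
`…AssemblyAtBarOfRangeAt` → `…RecTowerAtBridge` → this file (memo `Cruxes/StarredOptimalManinUnitFiveSeven/Lines/kato-lever-seam-rec-at-cells.md`).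

WHY. Skeleton v6 of the line (`Cruxes/…/Lines/kato_lever.lean`) closes K★ modulo {P1-bar, [REC-tower]} where [REC-tower] =
`tatePairingPoint_eq_trace_expStar_log_tower` quantifies over EVERY elliptic curve over EVERY field of characteristic `0` and EVERY tower
`F₀ ⊆ F` of `p`-adic fields — while the line's (K₂)^ram road and `…ReciprocityTowerFromAbove.exists_const_tower_clauses_of_formula_above`
construct Kato's formula only at the towers K★ actually consumes: `ℚ_v ⊆ ℚ(ζ_m)_w` (`v = (p)`, `p ∤ m`, `w ∣ p`) for the members `W′` of the
isogeny class of a curve `W/ℚ` in a K★ cell. This file states THAT as the hypothesis: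

* (bridge, sibling file `…RecTowerAtBridge`) ★ `rangeAt_of_recTowerAt` — [REC-tower] at a tower ⟹ (S5b-tower) at that tower; ★
  `recTowerAt_cyclotomic_of_reciprocityLaw` — the ∀-fields [REC-tower] implies the two hypotheses below (v7 is not weaker than v6).
* §1 ★★ `starredOptimalManinUnit_ordinaryCells_of_recTowerAt_of_sl2NeronValuesBar`, ★★ `…_supersingularCells_of_recTowerAt_…`,
  ★★★ `starredOptimalManinUnitFiveSeven_of_recTowerAt_of_sl2NeronValuesBar : hRECord → hRECss → P1-bar → K★` — the cell closers of
  `…CellsOfSL2NeronValuesBar` VERBATIM with the ∀-fields cite fact hT₂ replaced by `hRECord` / `hRECss`: **the body of [REC-tower] for every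
  globally minimal member `W′ ∼ W` of the class of a curve `W` in the (G)-ordinary cells `(5; III*), (7; IV*), (7; II*)` resp. the potentially
  supersingular cells `(5; IV*), (5; II*), (7; III*)`, at every tower `ℚ_v ⊆ ℚ(ζ_m)_w` with `p ∤ m`.** These two hypotheses are the new stubs
  of skeleton v7; both are implied by [REC-tower] (so v7 is not weaker than v6), and they are exactly what the line constructs.

References: [Kato1993LNM1553] Ch. II §1.2.4, Prop. 1.2.3, Thm. 1.4.1 (3)–(4), Lemma 1.4.3–1.4.5; [BlochKato1990] Prop. 3.8, Ex. 3.11;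
[Kato2004Asterisque] (8.1.3), Thm. 9.7, Thm. 6.6 (1); [KimNakamura2020] Cor. 2.4; [EdixhovenManin1991] Thm. 3; [MilneADT2006] I §3 Cor. 3.4.
-/

set_option autoImplicit false
-- the Theorems namespace of a single-conjunct summit repeats the summit name by design (D-0017)
set_option linter.dupNamespace false

noncomputable section

open scoped Classical MatrixGroups NumberField NNReal

open WeierstrassCurve NumberField IsDedekindDomain Field ValuativeRel
  Literature.NumberTheory.EllipticCurves Literature.NumberTheory.EllipticCurves.ModularForms
  Literature.NumberTheory.EllipticCurves.Rank1Residual Literature.NumberTheory.EllipticCurves.Kato2004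
  Literature.NumberTheory.DiophantineGeometry Rat.HeightOneSpectrum
  Literature.NumberTheory.PAdicHodge Literature.NumberTheory.GaloisRepresentations
  Literature.NumberTheory.GaloisRepresentations.IsNonarchimedeanLocalField
  Literature.NumberTheory.GaloisRepresentations.PeriodRingData
  Summit.BirchSwinnertonDyer.Rank1Residual Summit.BirchSwinnertonDyer.Rank1Residual.Additive
  Summit.BirchSwinnertonDyer.Rank1Residual.GaloisImage
  Summit.BirchSwinnertonDyer.BirchSwinnertonDyer.Theorems
  Summit.BirchSwinnertonDyer.BirchSwinnertonDyer.Theorems.KatoAssemblySocketAt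
  Summit.BirchSwinnertonDyer.BirchSwinnertonDyer.Theorems.ManinFrameResidueProperRTameTwistAt
  Summit.BirchSwinnertonDyer.BirchSwinnertonDyer.Theorems.StarredOptimalManinUnitFiveSevenSupersingularCellsExplicit
  Summit.BirchSwinnertonDyer.BirchSwinnertonDyer.Theorems.StarredOptimalManinUnitFiveSevenCellsOfSL2NeronValuesBar
  Summit.BirchSwinnertonDyer.BirchSwinnertonDyer.Theorems.StarredOptimalManinUnitFiveSevenAssemblyAtBarOfRangeAt
  Summit.BirchSwinnertonDyer.BirchSwinnertonDyer.Theorems.KimAtThreeDeepLowerExpStarOmega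
  Summit.BirchSwinnertonDyer.BirchSwinnertonDyer.Theorems.KimAtThreeDeepLowerExpStarOmegaPlace
  Summit.BirchSwinnertonDyer.BirchSwinnertonDyer.Theorems.KimAtThreeDeepLowerExpStarOmegaRes
  Summit.BirchSwinnertonDyer.BirchSwinnertonDyer.Theorems.KimAtThreeDeepUpperExpStarTransport
  Summit.BirchSwinnertonDyer.BirchSwinnertonDyer.Theorems.KimAtThreeDeepUpperExpStarFacts
  Summit.BirchSwinnertonDyer.BirchSwinnertonDyer.Theorems.KimAtThreeDeepUpperExpStarFactsCanonical
open Summit.BirchSwinnertonDyer.BirchSwinnertonDyer.Theorems.KimAtThreeDeepUpperTowerLattice (fact_natCast_mem_primesEquiv_symm)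
open Literature.NumberTheory.EllipticCurves.FormalGroupChart (padicLogPointFiniteExt)
open CategoryTheory
open Summit.BirchSwinnertonDyer.BirchSwinnertonDyer.Theorems.StarredOptimalManinUnitFiveSevenRecTowerAtBridge

namespace Summit.BirchSwinnertonDyer.BirchSwinnertonDyer.Theorems.StarredOptimalManinUnitFiveSevenCellsOfRecTowerAt

-- FILE-LOCAL instance keys, byte-identical to the accepted `…SemiLocalIntegralityPinAt.lean` l.164–169 (no library instance is
-- overridden outside this file): the `Fact (p ∈ v_p)` key and the local-field structures on `ℚ_v = Place.Completion (inr v)`, under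
-- which the bodies of (S5b-tower) / [REC-tower] at `ℚ_v ⊆ L` are stated.
attribute [local instance] fact_natCast_mem_primesEquiv_symm
attribute [local instance 100000] NumberField.Place.instAlgebraCompletion
attribute [local instance] valuativeRelPlace topologicalSpacePlace
attribute [local instance] isNonarchimedeanLocalField_place charZero_place
attribute [local instance] padicAlgebraPlace fact_not_isUnit_place isAdicComplete_place

/-! ## §1 The K★ cell closers, GRANTED P1-bar and [REC-tower] AT THE CELLS' TOWERS -/

section Cells

/-- The two standard side facts of the K★ cells used by the tame-twist lever: no `p`-torsion over `ℚ_p` on `4 ≤ ord_p Δ_min`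
(`eq_zero_of_prime_nsmul_eq_zero_of_addv_of_four_le`) and `a_ℓ ∈ {±1}` at the primes `ℓ ∥ N` (Kraus–Oesterlé). [cite: KostersPannekoek2017, Thm. 1]
[cite: EdixhovenManin1991, Thm. 3] -/
theorem cell_sideFacts (W : WeierstrassCurve ℚ) [W.IsElliptic] [W.IsGloballyMinimal] (p : ℕ) [Fact p.Prime]
    (hp57 : p = 5 ∨ p = 7) (hadd : Addv W p) (h4 : 4 < padicValInt p W.minimalDiscriminantInt) :
    5 ≤ p ∧ (∀ P : (W.baseChange ℚ_[p]).toAffine.Point, p • P = 0 → P = 0) ∧ p ^ 2 ∣ W.conductorNorm ℤ ∧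
      (∀ ℓ ∈ (W.conductorNorm ℤ).primeFactors, ¬ ℓ ^ 2 ∣ W.conductorNorm ℤ → W.LFunction ℓ = 1 ∨ W.LFunction ℓ = -1) := by
  have hp5 : 5 ≤ p := by rcases hp57 with rfl | rfl <;> norm_num
  refine ⟨hp5, fun P hP ↦ eq_zero_of_prime_nsmul_eq_zero_of_addv_of_four_le W p hp5 hadd (le_of_lt h4) hP,
    sq_dvd_conductorNorm_of_not_good_of_not_mult hadd, fun ℓ hℓ hℓ2 ↦ ?_⟩
  haveI : Fact ℓ.Prime := ⟨Nat.prime_of_mem_primeFactors hℓ⟩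
  rcases hasGoodReductionAtPrime_or_hasMultiplicativeReductionAtPrime_of_not_sq_dvd_conductorNorm (V := W) hℓ2 with hg | hmul
  · exact absurd (Nat.dvd_of_mem_primeFactors hℓ) (not_dvd_conductorNorm_of_hasGoodReductionAtPrime W hg)
  · exact KrausOesterle1992.lFunction_apply_prime_eq_one_or_eq_neg_one_of_mult W ℓ hmul

/-- ★★ **K★ on the three (G)-ORDINARY starred cells `(5; III*), (7; IV*), (7; II*)` GRANTED ONLY P1-bar and [REC-tower] AT THE CELLS' TOWERS.**
`…CellsOfSL2NeronValuesBar.starredOptimalManinUnit_ordinaryCells_of_sl2NeronValuesBar` VERBATIM (for `W/ℚ` globally minimal, `p ∈ {5, 7}`,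
additive at `p`, `E[p]` irreducible, no `Iₙ*` fibre at `p`, `4 < ord_p Δ_min`, on the half `p = 5 ↔ ord_p Δ_min = 9`, and `D` lattice-optimal at
the conductor level: `p ∤ c(D)`), with the ∀-fields cite fact hT₂ replaced by `hRECord`: the body of Kato's reciprocity law [REC-tower] for every
globally minimal member `W′ ∼ W` of such a class at every tower `ℚ_v ⊆ ℚ(ζ_m)_w`, `p ∤ m`. Proof: the original's, with the F″ body read through
`…AssemblyAtBarOfRangeAt.katoNeronBody_of_sl2NeronValuesBar_of_rangeAt`, whose `hT₂V` is `rangeAt_of_recTowerAt ∘ hRECord`. CONDITIONAL on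
P1-bar (cite-only) and the displayed `hRECord`; nothing is closed. [cite: Kato2004Asterisque, (8.1.3) (p. 180), Thm. 9.7 (p. 189)]
[cite: Kato1993LNM1553, Ch. II Thm. 1.4.1 (3)–(4)] [cite: KimNakamura2020, Cor. 2.4] [cite: KostersPannekoek2017, Thm. 1]
[cite: DokchitserDokchitser2015LocalInvariants, Thm. 3.2] -/
theorem starredOptimalManinUnit_ordinaryCells_of_recTowerAt_of_sl2NeronValuesBar
    (hRECord : ∀ (W : WeierstrassCurve ℚ) [W.IsElliptic] [W.IsGloballyMinimal] (p : ℕ) [hp : Fact p.Prime], (p = 5 ∨ p = 7) → Addv W p → Irr W p →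
      (∀ (v : HeightOneSpectrum ℤ) (n : ℕ), natGenerator v = p → W.kodairaSymbolAt v ≠ KodairaSymbol.Istar n) →
      4 < padicValInt p W.minimalDiscriminantInt → (p = 5 ↔ padicValInt p W.minimalDiscriminantInt = 9) →
      ∀ (W' : WeierstrassCurve ℚ) [W'.IsElliptic] [W'.IsGloballyMinimal], WeierstrassCurve.IsIsogenous W W' → ∀ (m : ℕ) [NeZero m], ¬ p ∣ m →
      ∀ (w : ((primesEquiv (R := 𝓞 ℚ)).symm ⟨p, hp.out⟩).Extension (𝓞 (CyclotomicField m ℚ))) (hw : ((p : ℕ) : 𝓞 (CyclotomicField m ℚ)) ∈ w.1.asIdeal)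
      [CharZero (w.1.adicCompletion (CyclotomicField m ℚ))] [Fact (¬ IsUnit ((p : ℕ) : integerC (w.1.adicCompletion (CyclotomicField m ℚ))))]
      [IsAdicComplete (Ideal.span {((p : ℕ) : integerC (w.1.adicCompletion (CyclotomicField m ℚ)))}) (integerC (w.1.adicCompletion (CyclotomicField m ℚ)))]
      (hL : valuation (w.1.adicCompletion (CyclotomicField m ℚ)) ((p : ℕ) : (w.1.adicCompletion (CyclotomicField m ℚ))) < 1), letI := LocalField.adicCompletionPadicAlgebra w.1 p hw
      letI : Algebra (Place.Completion (K := ℚ) (Sum.inr ((primesEquiv (R := 𝓞 ℚ)).symm ⟨p, hp.out⟩))) (w.1.adicCompletion (CyclotomicField m ℚ)) :=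
      inferInstanceAs (Algebra (((primesEquiv (R := 𝓞 ℚ)).symm ⟨p, hp.out⟩).adicCompletion ℚ) (w.1.adicCompletion (CyclotomicField m ℚ)))
      ∀ (wv : Valuation (Place.Completion (Sum.inr ((primesEquiv (R := 𝓞 ℚ)).symm ⟨p, hp.out⟩) : Place ℚ)) ℝ≥0) [wv.Compatible]
      [(W'.baseChange (Place.Completion (Sum.inr ((primesEquiv (R := 𝓞 ℚ)).symm ⟨p, hp.out⟩) : Place ℚ))).IsIntegral wv.integer]
      (ν : Valuation (w.1.adicCompletion (CyclotomicField m ℚ)) ℝ≥0) [ν.Compatible] [(W'.baseChange (w.1.adicCompletion (CyclotomicField m ℚ))).IsIntegral ν.integer]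
      (e : (k : ℕ) → geomTorsion W' ((p ^ k : ℕ) : ℤ) → geomTorsion W' ((p ^ k : ℕ) : ℤ) → AlgebraicClosure ℚ) (hμ : ∀ k S T, e k S T ^ (p ^ k) = 1)
      (hadd₁ : ∀ k S₁ S₂ T, e k (S₁ + S₂) T = e k S₁ T * e k S₂ T) (hadd₂ : ∀ k S T₁ T₂, e k S (T₁ + T₂) = e k S T₁ * e k S T₂)
      (hgal : ∀ k (σ : absoluteGaloisGroup ℚ) (S T : geomTorsion W' ((p ^ k : ℕ) : ℤ)), σ • e k S T = e k (σ • S) (σ • T))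
      (_hnondeg : ∀ k (T : geomTorsion W' ((p ^ k : ℕ) : ℤ)), (∀ S, e k S T = 1) → T = 0) (hcompat : ∀ k (S T : geomTorsion W' ((p ^ (k + 1) : ℕ) : ℤ)),
      e k (torsionMulHom W' (p ^ (k + 1)) (p ^ k) p (pow_succ p k).symm S) (torsionMulHom W' (p ^ (k + 1)) (p ^ k) p (pow_succ p k).symm T) = e (k + 1) S T ^ p)
      (d₀ : LocalNeronLineAt W' p ((primesEquiv (R := 𝓞 ℚ)).symm ⟨p, hp.out⟩)) (d : LocalNeronLine W' hL ((galRestrictPlace ((primesEquiv (R := 𝓞 ℚ)).symm ⟨p, hp.out⟩)).comp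
      (absGaloisRestrict (Place.Completion (Sum.inr ((primesEquiv (R := 𝓞 ℚ)).symm ⟨p, hp.out⟩) : Place ℚ)) (w.1.adicCompletion (CyclotomicField m ℚ))))),
      (bdRPeriodRingData (valuation_place_lt_one p ((primesEquiv (R := 𝓞 ℚ)).symm ⟨p, hp.out⟩))).CupLogInjective (logCyclotomic p)
      (localRationalTateRep W' p (galRestrictPlace ((primesEquiv (R := 𝓞 ℚ)).symm ⟨p, hp.out⟩))) →
      (∀ z : contOneCocycles (localRationalTateRep W' p (galRestrictPlace ((primesEquiv (R := 𝓞 ℚ)).symm ⟨p, hp.out⟩))).toTopRep,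
      (bdRPeriodRingData (valuation_place_lt_one p ((primesEquiv (R := 𝓞 ℚ)).symm ⟨p, hp.out⟩))).HasDualExp (logCyclotomic p)
      (localRationalTateRep W' p (galRestrictPlace ((primesEquiv (R := 𝓞 ℚ)).symm ⟨p, hp.out⟩))) fun σ => z.1 σ) →
      (bdRPeriodRingData (F := (w.1.adicCompletion (CyclotomicField m ℚ))) (p := p) hL).CupLogInjective (logCyclotomic p) (localRationalTateRep W' p
      ((galRestrictPlace ((primesEquiv (R := 𝓞 ℚ)).symm ⟨p, hp.out⟩)).comp (absGaloisRestrict (Place.Completion (Sum.inr ((primesEquiv (R := 𝓞 ℚ)).symm ⟨p, hp.out⟩) : Place ℚ)) (w.1.adicCompletion (CyclotomicField m ℚ))))) →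
      (∀ z : contOneCocycles (localRationalTateRep W' p
      ((galRestrictPlace ((primesEquiv (R := 𝓞 ℚ)).symm ⟨p, hp.out⟩)).comp (absGaloisRestrict (Place.Completion (Sum.inr ((primesEquiv (R := 𝓞 ℚ)).symm ⟨p, hp.out⟩) : Place ℚ)) (w.1.adicCompletion (CyclotomicField m ℚ))))).toTopRep,
      (bdRPeriodRingData (F := (w.1.adicCompletion (CyclotomicField m ℚ))) (p := p) hL).HasDualExp (logCyclotomic p) (localRationalTateRep W' p
      ((galRestrictPlace ((primesEquiv (R := 𝓞 ℚ)).symm ⟨p, hp.out⟩)).comp (absGaloisRestrict (Place.Completion (Sum.inr ((primesEquiv (R := 𝓞 ℚ)).symm ⟨p, hp.out⟩) : Place ℚ)) (w.1.adicCompletion (CyclotomicField m ℚ)))))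
      fun σ => z.1 σ) → (∀ (η₀ : contOneCocycles (restrictedTateRep W' (Place.Completion (Sum.inr ((primesEquiv (R := 𝓞 ℚ)).symm ⟨p, hp.out⟩) : Place ℚ)) p).toTopRep)
      (ηT : contOneCocycles ((restrictedTateRep W' (Place.Completion (Sum.inr ((primesEquiv (R := 𝓞 ℚ)).symm ⟨p, hp.out⟩) : Place ℚ)) p).restrict
      (absGaloisRestrict (Place.Completion (Sum.inr ((primesEquiv (R := 𝓞 ℚ)).symm ⟨p, hp.out⟩) : Place ℚ)) (w.1.adicCompletion (CyclotomicField m ℚ)))).toTopRep),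
      (∀ σ, ηT.1 σ = η₀.1 (absGaloisRestrict (Place.Completion (Sum.inr ((primesEquiv (R := 𝓞 ℚ)).symm ⟨p, hp.out⟩) : Place ℚ)) (w.1.adicCompletion (CyclotomicField m ℚ)) σ)) →
      expStarCoordTower W' (F₀ := (Place.Completion (Sum.inr ((primesEquiv (R := 𝓞 ℚ)).symm ⟨p, hp.out⟩) : Place ℚ))) hL d ηT =
      algebraMap (Place.Completion (Sum.inr ((primesEquiv (R := 𝓞 ℚ)).symm ⟨p, hp.out⟩) : Place ℚ)) (w.1.adicCompletion (CyclotomicField m ℚ))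
      (expStarCoord W' (valuation_place_lt_one p ((primesEquiv (R := 𝓞 ℚ)).symm ⟨p, hp.out⟩)) d₀ η₀)) →
      ∃ c : (Place.Completion (Sum.inr ((primesEquiv (R := 𝓞 ℚ)).symm ⟨p, hp.out⟩) : Place ℚ)), c ≠ 0 ∧
      (∀ (η₀ : contOneCocycles (restrictedTateRep W' (Place.Completion (Sum.inr ((primesEquiv (R := 𝓞 ℚ)).symm ⟨p, hp.out⟩) : Place ℚ)) p).toTopRep)
      (P : (W'.baseChange (Place.Completion (Sum.inr ((primesEquiv (R := 𝓞 ℚ)).symm ⟨p, hp.out⟩) : Place ℚ))).toAffine.Point),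
      ((tatePairingPoint W' (Place.Completion (Sum.inr ((primesEquiv (R := 𝓞 ℚ)).symm ⟨p, hp.out⟩) : Place ℚ)) p e hμ hadd₁ hadd₂ hgal hcompat (oneCocycleClass _ η₀) P : ℤ_[p]) : ℚ_[p]) =
      Algebra.trace ℚ_[p] (Place.Completion (Sum.inr ((primesEquiv (R := 𝓞 ℚ)).symm ⟨p, hp.out⟩) : Place ℚ))
      (c * expStarCoord W' (valuation_place_lt_one p ((primesEquiv (R := 𝓞 ℚ)).symm ⟨p, hp.out⟩)) d₀ η₀ *
      padicLogPointFiniteExt wv (W'.baseChange (Place.Completion (Sum.inr ((primesEquiv (R := 𝓞 ℚ)).symm ⟨p, hp.out⟩) : Place ℚ))) p P)) ∧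
      (∀ (ηT : contOneCocycles ((restrictedTateRep W' (Place.Completion (Sum.inr ((primesEquiv (R := 𝓞 ℚ)).symm ⟨p, hp.out⟩) : Place ℚ)) p).restrict
      (absGaloisRestrict (Place.Completion (Sum.inr ((primesEquiv (R := 𝓞 ℚ)).symm ⟨p, hp.out⟩) : Place ℚ)) (w.1.adicCompletion (CyclotomicField m ℚ)))).toTopRep)
      (P : (W'.baseChange (w.1.adicCompletion (CyclotomicField m ℚ))).toAffine.Point),
      ((tatePairingPointTower W' (Place.Completion (Sum.inr ((primesEquiv (R := 𝓞 ℚ)).symm ⟨p, hp.out⟩) : Place ℚ)) e hμ hadd₁ hadd₂ hgal hcompat (oneCocycleClass _ ηT) P : ℤ_[p]) : ℚ_[p]) =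
      Algebra.trace ℚ_[p] (w.1.adicCompletion (CyclotomicField m ℚ))
      (algebraMap (Place.Completion (Sum.inr ((primesEquiv (R := 𝓞 ℚ)).symm ⟨p, hp.out⟩) : Place ℚ)) (w.1.adicCompletion (CyclotomicField m ℚ)) c * expStarCoordTower W' (F₀ := (Place.Completion (Sum.inr ((primesEquiv (R := 𝓞 ℚ)).symm ⟨p, hp.out⟩) : Place ℚ))) hL d ηT *
      padicLogPointFiniteExt ν (W'.baseChange (w.1.adicCompletion (CyclotomicField m ℚ))) p P)))
    (hP1 : exists_member_sl2ZetaElement_neron_values_bar)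
    (W : WeierstrassCurve ℚ) [W.IsElliptic] [W.IsGloballyMinimal] (p : ℕ) [hp : Fact p.Prime] {N : ℕ} [NeZero N]
    (D : ModularParametrizationData W N) (hN : N = W.conductorNorm ℤ) (hp57 : p = 5 ∨ p = 7) (hadd : Addv W p) (hirr : Irr W p)
    (hIstar : ∀ (v : HeightOneSpectrum ℤ) (n : ℕ), natGenerator v = p → W.kodairaSymbolAt v ≠ KodairaSymbol.Istar n)
    (h4 : 4 < padicValInt p W.minimalDiscriminantInt) (hord : p = 5 ↔ padicValInt p W.minimalDiscriminantInt = 9)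
    (hopt : ∀ z ∈ D.L.lattice, ∃ w ∈ periodLattice D.f, z = D.c * w) :
    ¬ (p : ℤ) ∣ D.c := by
  subst hN
  obtain ⟨-, hPT, hpN, ha⟩ := cell_sideFacts W p hp57 hadd h4
  refine not_dvd_c_of_tameTwist57_at hp57 W ?_ D hopt hPT hadd hirr hpN ha
  intro M _ g hg hp5' hng hnm hirr' m _ hcop hcl χ hχ hχ1 hord' ϖ r
  refine katoNeronBody_of_sl2NeronValuesBar_of_rangeAt cupLogInjective_and_hasDualExp_of_isDeRham_holds hP1 W p
    ?_ g hg hp5' hng hnm hirr' m hcop ?_ hcl χ hχ hχ1 hord' ϖ r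
  · intro v hpv _ _ _ hp' _
    exact isDeRham_restrictedRationalTateRep_adicCompletion_rat_of_starred_fiveSeven_ordinary W p hp57 hadd hIstar h4 hord
      v hpv hp'
  · intro W' _ _ hiso w hw _ _ _ hL
    letI := LocalField.adicCompletionPadicAlgebra w.1 p hw
    letI : Algebra (Place.Completion (K := ℚ) (Sum.inr ((primesEquiv (R := 𝓞 ℚ)).symm ⟨p, hp.out⟩)))
        (w.1.adicCompletion (CyclotomicField m ℚ)) :=
      inferInstanceAs (Algebra (((primesEquiv (R := 𝓞 ℚ)).symm ⟨p, hp.out⟩).adicCompletion ℚ)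
        (w.1.adicCompletion (CyclotomicField m ℚ)))
    exact rangeAt_of_recTowerAt W' p ((primesEquiv (R := 𝓞 ℚ)).symm ⟨p, hp.out⟩) hL
      (hRECord W p hp57 hadd hirr hIstar h4 hord W' hiso m (KatoAssemblySocket.not_dvd_of_coprime_mul hcop) w hw hL)

/-- ★★ **K★ on the three potentially SUPERSINGULAR starred cells `(5; IV*), (5; II*), (7; III*)` GRANTED ONLY P1-bar and [REC-tower] AT THE
CELLS' TOWERS** (de Rham input: the tree's explicit-model capstone `explicitCapstone_holds` through `isDeRham_supersingularCells_of_explicitCapstone`).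
The supersingular branch of `…CellsOfSL2NeronValuesBar.starredOptimalManinUnitFiveSeven_of_sl2NeronValuesBar_of_explicitCapstone` with hT₂ replaced by
`hRECss` (the body of [REC-tower] for every member `W′ ∼ W` of such a class at every tower `ℚ_v ⊆ ℚ(ζ_m)_w`, `p ∤ m`). CONDITIONAL; nothing is closed.
[cite: Kato2004Asterisque, (8.1.3) (p. 180), Thm. 9.7 (p. 189)] [cite: Kato1993LNM1553, Ch. II Thm. 1.4.1 (3)–(4)]
[cite: Fontaine1982FormesDifferentielles, §5] [cite: EdixhovenManin1991, Thm. 3] -/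
theorem starredOptimalManinUnit_supersingularCells_of_recTowerAt_of_sl2NeronValuesBar
    (hRECss : ∀ (W : WeierstrassCurve ℚ) [W.IsElliptic] [W.IsGloballyMinimal] (p : ℕ) [hp : Fact p.Prime], (p = 5 ∨ p = 7) → Addv W p → Irr W p →
      (∀ (v : HeightOneSpectrum ℤ) (n : ℕ), natGenerator v = p → W.kodairaSymbolAt v ≠ KodairaSymbol.Istar n) →
      4 < padicValInt p W.minimalDiscriminantInt → ¬ (p = 5 ↔ padicValInt p W.minimalDiscriminantInt = 9) →
      ∀ (W' : WeierstrassCurve ℚ) [W'.IsElliptic] [W'.IsGloballyMinimal], WeierstrassCurve.IsIsogenous W W' → ∀ (m : ℕ) [NeZero m], ¬ p ∣ m →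
      ∀ (w : ((primesEquiv (R := 𝓞 ℚ)).symm ⟨p, hp.out⟩).Extension (𝓞 (CyclotomicField m ℚ))) (hw : ((p : ℕ) : 𝓞 (CyclotomicField m ℚ)) ∈ w.1.asIdeal)
      [CharZero (w.1.adicCompletion (CyclotomicField m ℚ))] [Fact (¬ IsUnit ((p : ℕ) : integerC (w.1.adicCompletion (CyclotomicField m ℚ))))]
      [IsAdicComplete (Ideal.span {((p : ℕ) : integerC (w.1.adicCompletion (CyclotomicField m ℚ)))}) (integerC (w.1.adicCompletion (CyclotomicField m ℚ)))]
      (hL : valuation (w.1.adicCompletion (CyclotomicField m ℚ)) ((p : ℕ) : (w.1.adicCompletion (CyclotomicField m ℚ))) < 1), letI := LocalField.adicCompletionPadicAlgebra w.1 p hw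
      letI : Algebra (Place.Completion (K := ℚ) (Sum.inr ((primesEquiv (R := 𝓞 ℚ)).symm ⟨p, hp.out⟩))) (w.1.adicCompletion (CyclotomicField m ℚ)) :=
      inferInstanceAs (Algebra (((primesEquiv (R := 𝓞 ℚ)).symm ⟨p, hp.out⟩).adicCompletion ℚ) (w.1.adicCompletion (CyclotomicField m ℚ)))
      ∀ (wv : Valuation (Place.Completion (Sum.inr ((primesEquiv (R := 𝓞 ℚ)).symm ⟨p, hp.out⟩) : Place ℚ)) ℝ≥0) [wv.Compatible]
      [(W'.baseChange (Place.Completion (Sum.inr ((primesEquiv (R := 𝓞 ℚ)).symm ⟨p, hp.out⟩) : Place ℚ))).IsIntegral wv.integer]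
      (ν : Valuation (w.1.adicCompletion (CyclotomicField m ℚ)) ℝ≥0) [ν.Compatible] [(W'.baseChange (w.1.adicCompletion (CyclotomicField m ℚ))).IsIntegral ν.integer]
      (e : (k : ℕ) → geomTorsion W' ((p ^ k : ℕ) : ℤ) → geomTorsion W' ((p ^ k : ℕ) : ℤ) → AlgebraicClosure ℚ) (hμ : ∀ k S T, e k S T ^ (p ^ k) = 1)
      (hadd₁ : ∀ k S₁ S₂ T, e k (S₁ + S₂) T = e k S₁ T * e k S₂ T) (hadd₂ : ∀ k S T₁ T₂, e k S (T₁ + T₂) = e k S T₁ * e k S T₂)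
      (hgal : ∀ k (σ : absoluteGaloisGroup ℚ) (S T : geomTorsion W' ((p ^ k : ℕ) : ℤ)), σ • e k S T = e k (σ • S) (σ • T))
      (_hnondeg : ∀ k (T : geomTorsion W' ((p ^ k : ℕ) : ℤ)), (∀ S, e k S T = 1) → T = 0) (hcompat : ∀ k (S T : geomTorsion W' ((p ^ (k + 1) : ℕ) : ℤ)),
      e k (torsionMulHom W' (p ^ (k + 1)) (p ^ k) p (pow_succ p k).symm S) (torsionMulHom W' (p ^ (k + 1)) (p ^ k) p (pow_succ p k).symm T) = e (k + 1) S T ^ p)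
      (d₀ : LocalNeronLineAt W' p ((primesEquiv (R := 𝓞 ℚ)).symm ⟨p, hp.out⟩)) (d : LocalNeronLine W' hL ((galRestrictPlace ((primesEquiv (R := 𝓞 ℚ)).symm ⟨p, hp.out⟩)).comp
      (absGaloisRestrict (Place.Completion (Sum.inr ((primesEquiv (R := 𝓞 ℚ)).symm ⟨p, hp.out⟩) : Place ℚ)) (w.1.adicCompletion (CyclotomicField m ℚ))))),
      (bdRPeriodRingData (valuation_place_lt_one p ((primesEquiv (R := 𝓞 ℚ)).symm ⟨p, hp.out⟩))).CupLogInjective (logCyclotomic p)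
      (localRationalTateRep W' p (galRestrictPlace ((primesEquiv (R := 𝓞 ℚ)).symm ⟨p, hp.out⟩))) →
      (∀ z : contOneCocycles (localRationalTateRep W' p (galRestrictPlace ((primesEquiv (R := 𝓞 ℚ)).symm ⟨p, hp.out⟩))).toTopRep,
      (bdRPeriodRingData (valuation_place_lt_one p ((primesEquiv (R := 𝓞 ℚ)).symm ⟨p, hp.out⟩))).HasDualExp (logCyclotomic p)
      (localRationalTateRep W' p (galRestrictPlace ((primesEquiv (R := 𝓞 ℚ)).symm ⟨p, hp.out⟩))) fun σ => z.1 σ) →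
      (bdRPeriodRingData (F := (w.1.adicCompletion (CyclotomicField m ℚ))) (p := p) hL).CupLogInjective (logCyclotomic p) (localRationalTateRep W' p
      ((galRestrictPlace ((primesEquiv (R := 𝓞 ℚ)).symm ⟨p, hp.out⟩)).comp (absGaloisRestrict (Place.Completion (Sum.inr ((primesEquiv (R := 𝓞 ℚ)).symm ⟨p, hp.out⟩) : Place ℚ)) (w.1.adicCompletion (CyclotomicField m ℚ))))) →
      (∀ z : contOneCocycles (localRationalTateRep W' p
      ((galRestrictPlace ((primesEquiv (R := 𝓞 ℚ)).symm ⟨p, hp.out⟩)).comp (absGaloisRestrict (Place.Completion (Sum.inr ((primesEquiv (R := 𝓞 ℚ)).symm ⟨p, hp.out⟩) : Place ℚ)) (w.1.adicCompletion (CyclotomicField m ℚ))))).toTopRep,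
      (bdRPeriodRingData (F := (w.1.adicCompletion (CyclotomicField m ℚ))) (p := p) hL).HasDualExp (logCyclotomic p) (localRationalTateRep W' p
      ((galRestrictPlace ((primesEquiv (R := 𝓞 ℚ)).symm ⟨p, hp.out⟩)).comp (absGaloisRestrict (Place.Completion (Sum.inr ((primesEquiv (R := 𝓞 ℚ)).symm ⟨p, hp.out⟩) : Place ℚ)) (w.1.adicCompletion (CyclotomicField m ℚ)))))
      fun σ => z.1 σ) → (∀ (η₀ : contOneCocycles (restrictedTateRep W' (Place.Completion (Sum.inr ((primesEquiv (R := 𝓞 ℚ)).symm ⟨p, hp.out⟩) : Place ℚ)) p).toTopRep)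
      (ηT : contOneCocycles ((restrictedTateRep W' (Place.Completion (Sum.inr ((primesEquiv (R := 𝓞 ℚ)).symm ⟨p, hp.out⟩) : Place ℚ)) p).restrict
      (absGaloisRestrict (Place.Completion (Sum.inr ((primesEquiv (R := 𝓞 ℚ)).symm ⟨p, hp.out⟩) : Place ℚ)) (w.1.adicCompletion (CyclotomicField m ℚ)))).toTopRep),
      (∀ σ, ηT.1 σ = η₀.1 (absGaloisRestrict (Place.Completion (Sum.inr ((primesEquiv (R := 𝓞 ℚ)).symm ⟨p, hp.out⟩) : Place ℚ)) (w.1.adicCompletion (CyclotomicField m ℚ)) σ)) →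
      expStarCoordTower W' (F₀ := (Place.Completion (Sum.inr ((primesEquiv (R := 𝓞 ℚ)).symm ⟨p, hp.out⟩) : Place ℚ))) hL d ηT =
      algebraMap (Place.Completion (Sum.inr ((primesEquiv (R := 𝓞 ℚ)).symm ⟨p, hp.out⟩) : Place ℚ)) (w.1.adicCompletion (CyclotomicField m ℚ))
      (expStarCoord W' (valuation_place_lt_one p ((primesEquiv (R := 𝓞 ℚ)).symm ⟨p, hp.out⟩)) d₀ η₀)) →
      ∃ c : (Place.Completion (Sum.inr ((primesEquiv (R := 𝓞 ℚ)).symm ⟨p, hp.out⟩) : Place ℚ)), c ≠ 0 ∧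
      (∀ (η₀ : contOneCocycles (restrictedTateRep W' (Place.Completion (Sum.inr ((primesEquiv (R := 𝓞 ℚ)).symm ⟨p, hp.out⟩) : Place ℚ)) p).toTopRep)
      (P : (W'.baseChange (Place.Completion (Sum.inr ((primesEquiv (R := 𝓞 ℚ)).symm ⟨p, hp.out⟩) : Place ℚ))).toAffine.Point),
      ((tatePairingPoint W' (Place.Completion (Sum.inr ((primesEquiv (R := 𝓞 ℚ)).symm ⟨p, hp.out⟩) : Place ℚ)) p e hμ hadd₁ hadd₂ hgal hcompat (oneCocycleClass _ η₀) P : ℤ_[p]) : ℚ_[p]) =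
      Algebra.trace ℚ_[p] (Place.Completion (Sum.inr ((primesEquiv (R := 𝓞 ℚ)).symm ⟨p, hp.out⟩) : Place ℚ))
      (c * expStarCoord W' (valuation_place_lt_one p ((primesEquiv (R := 𝓞 ℚ)).symm ⟨p, hp.out⟩)) d₀ η₀ *
      padicLogPointFiniteExt wv (W'.baseChange (Place.Completion (Sum.inr ((primesEquiv (R := 𝓞 ℚ)).symm ⟨p, hp.out⟩) : Place ℚ))) p P)) ∧
      (∀ (ηT : contOneCocycles ((restrictedTateRep W' (Place.Completion (Sum.inr ((primesEquiv (R := 𝓞 ℚ)).symm ⟨p, hp.out⟩) : Place ℚ)) p).restrict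
      (absGaloisRestrict (Place.Completion (Sum.inr ((primesEquiv (R := 𝓞 ℚ)).symm ⟨p, hp.out⟩) : Place ℚ)) (w.1.adicCompletion (CyclotomicField m ℚ)))).toTopRep)
      (P : (W'.baseChange (w.1.adicCompletion (CyclotomicField m ℚ))).toAffine.Point),
      ((tatePairingPointTower W' (Place.Completion (Sum.inr ((primesEquiv (R := 𝓞 ℚ)).symm ⟨p, hp.out⟩) : Place ℚ)) e hμ hadd₁ hadd₂ hgal hcompat (oneCocycleClass _ ηT) P : ℤ_[p]) : ℚ_[p]) =
      Algebra.trace ℚ_[p] (w.1.adicCompletion (CyclotomicField m ℚ))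
      (algebraMap (Place.Completion (Sum.inr ((primesEquiv (R := 𝓞 ℚ)).symm ⟨p, hp.out⟩) : Place ℚ)) (w.1.adicCompletion (CyclotomicField m ℚ)) c * expStarCoordTower W' (F₀ := (Place.Completion (Sum.inr ((primesEquiv (R := 𝓞 ℚ)).symm ⟨p, hp.out⟩) : Place ℚ))) hL d ηT *
      padicLogPointFiniteExt ν (W'.baseChange (w.1.adicCompletion (CyclotomicField m ℚ))) p P)))
    (hP1 : exists_member_sl2ZetaElement_neron_values_bar)
    (W : WeierstrassCurve ℚ) [W.IsElliptic] [W.IsGloballyMinimal] (p : ℕ) [hp : Fact p.Prime] {N : ℕ} [NeZero N]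
    (D : ModularParametrizationData W N) (hN : N = W.conductorNorm ℤ) (hp57 : p = 5 ∨ p = 7) (hadd : Addv W p) (hirr : Irr W p)
    (hIstar : ∀ (v : HeightOneSpectrum ℤ) (n : ℕ), natGenerator v = p → W.kodairaSymbolAt v ≠ KodairaSymbol.Istar n)
    (h4 : 4 < padicValInt p W.minimalDiscriminantInt) (hss : ¬ (p = 5 ↔ padicValInt p W.minimalDiscriminantInt = 9))
    (hopt : ∀ z ∈ D.L.lattice, ∃ w ∈ periodLattice D.f, z = D.c * w) :
    ¬ (p : ℤ) ∣ D.c := by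
  subst hN
  obtain ⟨-, hPT, hpN, ha⟩ := cell_sideFacts W p hp57 hadd h4
  refine not_dvd_c_of_tameTwist57_at hp57 W ?_ D hopt hPT hadd hirr hpN ha
  intro M _ g hg hp5' hng hnm hirr' m _ hcop hcl χ hχ hχ1 hord' ϖ r
  refine katoNeronBody_of_sl2NeronValuesBar_of_rangeAt cupLogInjective_and_hasDualExp_of_isDeRham_holds hP1 W p
    ?_ g hg hp5' hng hnm hirr' m hcop ?_ hcl χ hχ hχ1 hord' ϖ r
  · intro v hpv _ _ _ hp' _
    exact isDeRham_supersingularCells_of_explicitCapstone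
      StarredOptimalManinUnitFiveSevenSupersingularCellsDeRhamHolds.explicitCapstone_holds W p hp57 hadd hirr hIstar h4 hss v hpv hp'
  · intro W' _ _ hiso w hw _ _ _ hL
    letI := LocalField.adicCompletionPadicAlgebra w.1 p hw
    letI : Algebra (Place.Completion (K := ℚ) (Sum.inr ((primesEquiv (R := 𝓞 ℚ)).symm ⟨p, hp.out⟩)))
        (w.1.adicCompletion (CyclotomicField m ℚ)) :=
      inferInstanceAs (Algebra (((primesEquiv (R := 𝓞 ℚ)).symm ⟨p, hp.out⟩).adicCompletion ℚ)
        (w.1.adicCompletion (CyclotomicField m ℚ)))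
    exact rangeAt_of_recTowerAt W' p ((primesEquiv (R := 𝓞 ℚ)).symm ⟨p, hp.out⟩) hL
      (hRECss W p hp57 hadd hirr hIstar h4 hss W' hiso m (KatoAssemblySocket.not_dvd_of_coprime_mul hcop) w hw hL)

/-- ★★★ **K★ `StarredOptimalManinUnitFiveSeven` BY NAME ⟸ {[REC-tower] at the (G)-ordinary cells' towers, [REC-tower] at the supersingular
cells' towers, P1-bar} — and nothing else.** The composition of skeleton v7 of the line `kato_lever`: the two displayed hypotheses are the body of
Kato's explicit reciprocity law `tatePairingPoint_eq_trace_expStar_log_tower` RESTRICTED to the members of the K★ isogeny classes and the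
cyclotomic towers `ℚ_v ⊆ ℚ(ζ_m)_w` (`p ∤ m`) — both implied by the ∀-fields cite fact of skeleton v6, and exactly what the (K₂)^ram road +
`…ReciprocityTowerFromAbove` construct; P1-bar = `Kato2004.exists_member_sl2ZetaElement_neron_values_bar` (print XL). CONDITIONAL on the three
displayed hypotheses; the item is NOT closed by this; BSD is not proved. [cite: Kato2004Asterisque, (8.1.3) (p. 180), Thm. 9.7 (p. 189), Thm. 6.6 (1) (p. 163)]
[cite: Kato1993LNM1553, Ch. II Thm. 1.4.1 (3)–(4)] [cite: Fontaine1982FormesDifferentielles, §5] [cite: EdixhovenManin1991, Thm. 3] -/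
theorem starredOptimalManinUnitFiveSeven_of_recTowerAt_of_sl2NeronValuesBar
    (hRECord : ∀ (W : WeierstrassCurve ℚ) [W.IsElliptic] [W.IsGloballyMinimal] (p : ℕ) [hp : Fact p.Prime], (p = 5 ∨ p = 7) → Addv W p → Irr W p →
      (∀ (v : HeightOneSpectrum ℤ) (n : ℕ), natGenerator v = p → W.kodairaSymbolAt v ≠ KodairaSymbol.Istar n) →
      4 < padicValInt p W.minimalDiscriminantInt → (p = 5 ↔ padicValInt p W.minimalDiscriminantInt = 9) →
      ∀ (W' : WeierstrassCurve ℚ) [W'.IsElliptic] [W'.IsGloballyMinimal], WeierstrassCurve.IsIsogenous W W' → ∀ (m : ℕ) [NeZero m], ¬ p ∣ m →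
      ∀ (w : ((primesEquiv (R := 𝓞 ℚ)).symm ⟨p, hp.out⟩).Extension (𝓞 (CyclotomicField m ℚ))) (hw : ((p : ℕ) : 𝓞 (CyclotomicField m ℚ)) ∈ w.1.asIdeal)
      [CharZero (w.1.adicCompletion (CyclotomicField m ℚ))] [Fact (¬ IsUnit ((p : ℕ) : integerC (w.1.adicCompletion (CyclotomicField m ℚ))))]
      [IsAdicComplete (Ideal.span {((p : ℕ) : integerC (w.1.adicCompletion (CyclotomicField m ℚ)))}) (integerC (w.1.adicCompletion (CyclotomicField m ℚ)))]
      (hL : valuation (w.1.adicCompletion (CyclotomicField m ℚ)) ((p : ℕ) : (w.1.adicCompletion (CyclotomicField m ℚ))) < 1), letI := LocalField.adicCompletionPadicAlgebra w.1 p hw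
      letI : Algebra (Place.Completion (K := ℚ) (Sum.inr ((primesEquiv (R := 𝓞 ℚ)).symm ⟨p, hp.out⟩))) (w.1.adicCompletion (CyclotomicField m ℚ)) :=
      inferInstanceAs (Algebra (((primesEquiv (R := 𝓞 ℚ)).symm ⟨p, hp.out⟩).adicCompletion ℚ) (w.1.adicCompletion (CyclotomicField m ℚ)))
      ∀ (wv : Valuation (Place.Completion (Sum.inr ((primesEquiv (R := 𝓞 ℚ)).symm ⟨p, hp.out⟩) : Place ℚ)) ℝ≥0) [wv.Compatible]
      [(W'.baseChange (Place.Completion (Sum.inr ((primesEquiv (R := 𝓞 ℚ)).symm ⟨p, hp.out⟩) : Place ℚ))).IsIntegral wv.integer]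
      (ν : Valuation (w.1.adicCompletion (CyclotomicField m ℚ)) ℝ≥0) [ν.Compatible] [(W'.baseChange (w.1.adicCompletion (CyclotomicField m ℚ))).IsIntegral ν.integer]
      (e : (k : ℕ) → geomTorsion W' ((p ^ k : ℕ) : ℤ) → geomTorsion W' ((p ^ k : ℕ) : ℤ) → AlgebraicClosure ℚ) (hμ : ∀ k S T, e k S T ^ (p ^ k) = 1)
      (hadd₁ : ∀ k S₁ S₂ T, e k (S₁ + S₂) T = e k S₁ T * e k S₂ T) (hadd₂ : ∀ k S T₁ T₂, e k S (T₁ + T₂) = e k S T₁ * e k S T₂)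
      (hgal : ∀ k (σ : absoluteGaloisGroup ℚ) (S T : geomTorsion W' ((p ^ k : ℕ) : ℤ)), σ • e k S T = e k (σ • S) (σ • T))
      (_hnondeg : ∀ k (T : geomTorsion W' ((p ^ k : ℕ) : ℤ)), (∀ S, e k S T = 1) → T = 0) (hcompat : ∀ k (S T : geomTorsion W' ((p ^ (k + 1) : ℕ) : ℤ)),
      e k (torsionMulHom W' (p ^ (k + 1)) (p ^ k) p (pow_succ p k).symm S) (torsionMulHom W' (p ^ (k + 1)) (p ^ k) p (pow_succ p k).symm T) = e (k + 1) S T ^ p)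
      (d₀ : LocalNeronLineAt W' p ((primesEquiv (R := 𝓞 ℚ)).symm ⟨p, hp.out⟩)) (d : LocalNeronLine W' hL ((galRestrictPlace ((primesEquiv (R := 𝓞 ℚ)).symm ⟨p, hp.out⟩)).comp
      (absGaloisRestrict (Place.Completion (Sum.inr ((primesEquiv (R := 𝓞 ℚ)).symm ⟨p, hp.out⟩) : Place ℚ)) (w.1.adicCompletion (CyclotomicField m ℚ))))),
      (bdRPeriodRingData (valuation_place_lt_one p ((primesEquiv (R := 𝓞 ℚ)).symm ⟨p, hp.out⟩))).CupLogInjective (logCyclotomic p)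
      (localRationalTateRep W' p (galRestrictPlace ((primesEquiv (R := 𝓞 ℚ)).symm ⟨p, hp.out⟩))) →
      (∀ z : contOneCocycles (localRationalTateRep W' p (galRestrictPlace ((primesEquiv (R := 𝓞 ℚ)).symm ⟨p, hp.out⟩))).toTopRep,
      (bdRPeriodRingData (valuation_place_lt_one p ((primesEquiv (R := 𝓞 ℚ)).symm ⟨p, hp.out⟩))).HasDualExp (logCyclotomic p)
      (localRationalTateRep W' p (galRestrictPlace ((primesEquiv (R := 𝓞 ℚ)).symm ⟨p, hp.out⟩))) fun σ => z.1 σ) →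
      (bdRPeriodRingData (F := (w.1.adicCompletion (CyclotomicField m ℚ))) (p := p) hL).CupLogInjective (logCyclotomic p) (localRationalTateRep W' p
      ((galRestrictPlace ((primesEquiv (R := 𝓞 ℚ)).symm ⟨p, hp.out⟩)).comp (absGaloisRestrict (Place.Completion (Sum.inr ((primesEquiv (R := 𝓞 ℚ)).symm ⟨p, hp.out⟩) : Place ℚ)) (w.1.adicCompletion (CyclotomicField m ℚ))))) →
      (∀ z : contOneCocycles (localRationalTateRep W' p
      ((galRestrictPlace ((primesEquiv (R := 𝓞 ℚ)).symm ⟨p, hp.out⟩)).comp (absGaloisRestrict (Place.Completion (Sum.inr ((primesEquiv (R := 𝓞 ℚ)).symm ⟨p, hp.out⟩) : Place ℚ)) (w.1.adicCompletion (CyclotomicField m ℚ))))).toTopRep,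
      (bdRPeriodRingData (F := (w.1.adicCompletion (CyclotomicField m ℚ))) (p := p) hL).HasDualExp (logCyclotomic p) (localRationalTateRep W' p
      ((galRestrictPlace ((primesEquiv (R := 𝓞 ℚ)).symm ⟨p, hp.out⟩)).comp (absGaloisRestrict (Place.Completion (Sum.inr ((primesEquiv (R := 𝓞 ℚ)).symm ⟨p, hp.out⟩) : Place ℚ)) (w.1.adicCompletion (CyclotomicField m ℚ)))))
      fun σ => z.1 σ) → (∀ (η₀ : contOneCocycles (restrictedTateRep W' (Place.Completion (Sum.inr ((primesEquiv (R := 𝓞 ℚ)).symm ⟨p, hp.out⟩) : Place ℚ)) p).toTopRep)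
      (ηT : contOneCocycles ((restrictedTateRep W' (Place.Completion (Sum.inr ((primesEquiv (R := 𝓞 ℚ)).symm ⟨p, hp.out⟩) : Place ℚ)) p).restrict
      (absGaloisRestrict (Place.Completion (Sum.inr ((primesEquiv (R := 𝓞 ℚ)).symm ⟨p, hp.out⟩) : Place ℚ)) (w.1.adicCompletion (CyclotomicField m ℚ)))).toTopRep),
      (∀ σ, ηT.1 σ = η₀.1 (absGaloisRestrict (Place.Completion (Sum.inr ((primesEquiv (R := 𝓞 ℚ)).symm ⟨p, hp.out⟩) : Place ℚ)) (w.1.adicCompletion (CyclotomicField m ℚ)) σ)) →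
      expStarCoordTower W' (F₀ := (Place.Completion (Sum.inr ((primesEquiv (R := 𝓞 ℚ)).symm ⟨p, hp.out⟩) : Place ℚ))) hL d ηT =
      algebraMap (Place.Completion (Sum.inr ((primesEquiv (R := 𝓞 ℚ)).symm ⟨p, hp.out⟩) : Place ℚ)) (w.1.adicCompletion (CyclotomicField m ℚ))
      (expStarCoord W' (valuation_place_lt_one p ((primesEquiv (R := 𝓞 ℚ)).symm ⟨p, hp.out⟩)) d₀ η₀)) →
      ∃ c : (Place.Completion (Sum.inr ((primesEquiv (R := 𝓞 ℚ)).symm ⟨p, hp.out⟩) : Place ℚ)), c ≠ 0 ∧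
      (∀ (η₀ : contOneCocycles (restrictedTateRep W' (Place.Completion (Sum.inr ((primesEquiv (R := 𝓞 ℚ)).symm ⟨p, hp.out⟩) : Place ℚ)) p).toTopRep)
      (P : (W'.baseChange (Place.Completion (Sum.inr ((primesEquiv (R := 𝓞 ℚ)).symm ⟨p, hp.out⟩) : Place ℚ))).toAffine.Point),
      ((tatePairingPoint W' (Place.Completion (Sum.inr ((primesEquiv (R := 𝓞 ℚ)).symm ⟨p, hp.out⟩) : Place ℚ)) p e hμ hadd₁ hadd₂ hgal hcompat (oneCocycleClass _ η₀) P : ℤ_[p]) : ℚ_[p]) =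
      Algebra.trace ℚ_[p] (Place.Completion (Sum.inr ((primesEquiv (R := 𝓞 ℚ)).symm ⟨p, hp.out⟩) : Place ℚ))
      (c * expStarCoord W' (valuation_place_lt_one p ((primesEquiv (R := 𝓞 ℚ)).symm ⟨p, hp.out⟩)) d₀ η₀ *
      padicLogPointFiniteExt wv (W'.baseChange (Place.Completion (Sum.inr ((primesEquiv (R := 𝓞 ℚ)).symm ⟨p, hp.out⟩) : Place ℚ))) p P)) ∧
      (∀ (ηT : contOneCocycles ((restrictedTateRep W' (Place.Completion (Sum.inr ((primesEquiv (R := 𝓞 ℚ)).symm ⟨p, hp.out⟩) : Place ℚ)) p).restrict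
      (absGaloisRestrict (Place.Completion (Sum.inr ((primesEquiv (R := 𝓞 ℚ)).symm ⟨p, hp.out⟩) : Place ℚ)) (w.1.adicCompletion (CyclotomicField m ℚ)))).toTopRep)
      (P : (W'.baseChange (w.1.adicCompletion (CyclotomicField m ℚ))).toAffine.Point),
      ((tatePairingPointTower W' (Place.Completion (Sum.inr ((primesEquiv (R := 𝓞 ℚ)).symm ⟨p, hp.out⟩) : Place ℚ)) e hμ hadd₁ hadd₂ hgal hcompat (oneCocycleClass _ ηT) P : ℤ_[p]) : ℚ_[p]) =
      Algebra.trace ℚ_[p] (w.1.adicCompletion (CyclotomicField m ℚ))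
      (algebraMap (Place.Completion (Sum.inr ((primesEquiv (R := 𝓞 ℚ)).symm ⟨p, hp.out⟩) : Place ℚ)) (w.1.adicCompletion (CyclotomicField m ℚ)) c * expStarCoordTower W' (F₀ := (Place.Completion (Sum.inr ((primesEquiv (R := 𝓞 ℚ)).symm ⟨p, hp.out⟩) : Place ℚ))) hL d ηT *
      padicLogPointFiniteExt ν (W'.baseChange (w.1.adicCompletion (CyclotomicField m ℚ))) p P)))
    (hRECss : ∀ (W : WeierstrassCurve ℚ) [W.IsElliptic] [W.IsGloballyMinimal] (p : ℕ) [hp : Fact p.Prime], (p = 5 ∨ p = 7) → Addv W p → Irr W p →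
      (∀ (v : HeightOneSpectrum ℤ) (n : ℕ), natGenerator v = p → W.kodairaSymbolAt v ≠ KodairaSymbol.Istar n) →
      4 < padicValInt p W.minimalDiscriminantInt → ¬ (p = 5 ↔ padicValInt p W.minimalDiscriminantInt = 9) →
      ∀ (W' : WeierstrassCurve ℚ) [W'.IsElliptic] [W'.IsGloballyMinimal], WeierstrassCurve.IsIsogenous W W' → ∀ (m : ℕ) [NeZero m], ¬ p ∣ m →
      ∀ (w : ((primesEquiv (R := 𝓞 ℚ)).symm ⟨p, hp.out⟩).Extension (𝓞 (CyclotomicField m ℚ))) (hw : ((p : ℕ) : 𝓞 (CyclotomicField m ℚ)) ∈ w.1.asIdeal)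
      [CharZero (w.1.adicCompletion (CyclotomicField m ℚ))] [Fact (¬ IsUnit ((p : ℕ) : integerC (w.1.adicCompletion (CyclotomicField m ℚ))))]
      [IsAdicComplete (Ideal.span {((p : ℕ) : integerC (w.1.adicCompletion (CyclotomicField m ℚ)))}) (integerC (w.1.adicCompletion (CyclotomicField m ℚ)))]
      (hL : valuation (w.1.adicCompletion (CyclotomicField m ℚ)) ((p : ℕ) : (w.1.adicCompletion (CyclotomicField m ℚ))) < 1), letI := LocalField.adicCompletionPadicAlgebra w.1 p hw
      letI : Algebra (Place.Completion (K := ℚ) (Sum.inr ((primesEquiv (R := 𝓞 ℚ)).symm ⟨p, hp.out⟩))) (w.1.adicCompletion (CyclotomicField m ℚ)) :=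
      inferInstanceAs (Algebra (((primesEquiv (R := 𝓞 ℚ)).symm ⟨p, hp.out⟩).adicCompletion ℚ) (w.1.adicCompletion (CyclotomicField m ℚ)))
      ∀ (wv : Valuation (Place.Completion (Sum.inr ((primesEquiv (R := 𝓞 ℚ)).symm ⟨p, hp.out⟩) : Place ℚ)) ℝ≥0) [wv.Compatible]
      [(W'.baseChange (Place.Completion (Sum.inr ((primesEquiv (R := 𝓞 ℚ)).symm ⟨p, hp.out⟩) : Place ℚ))).IsIntegral wv.integer]
      (ν : Valuation (w.1.adicCompletion (CyclotomicField m ℚ)) ℝ≥0) [ν.Compatible] [(W'.baseChange (w.1.adicCompletion (CyclotomicField m ℚ))).IsIntegral ν.integer]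
      (e : (k : ℕ) → geomTorsion W' ((p ^ k : ℕ) : ℤ) → geomTorsion W' ((p ^ k : ℕ) : ℤ) → AlgebraicClosure ℚ) (hμ : ∀ k S T, e k S T ^ (p ^ k) = 1)
      (hadd₁ : ∀ k S₁ S₂ T, e k (S₁ + S₂) T = e k S₁ T * e k S₂ T) (hadd₂ : ∀ k S T₁ T₂, e k S (T₁ + T₂) = e k S T₁ * e k S T₂)
      (hgal : ∀ k (σ : absoluteGaloisGroup ℚ) (S T : geomTorsion W' ((p ^ k : ℕ) : ℤ)), σ • e k S T = e k (σ • S) (σ • T))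
      (_hnondeg : ∀ k (T : geomTorsion W' ((p ^ k : ℕ) : ℤ)), (∀ S, e k S T = 1) → T = 0) (hcompat : ∀ k (S T : geomTorsion W' ((p ^ (k + 1) : ℕ) : ℤ)),
      e k (torsionMulHom W' (p ^ (k + 1)) (p ^ k) p (pow_succ p k).symm S) (torsionMulHom W' (p ^ (k + 1)) (p ^ k) p (pow_succ p k).symm T) = e (k + 1) S T ^ p)
      (d₀ : LocalNeronLineAt W' p ((primesEquiv (R := 𝓞 ℚ)).symm ⟨p, hp.out⟩)) (d : LocalNeronLine W' hL ((galRestrictPlace ((primesEquiv (R := 𝓞 ℚ)).symm ⟨p, hp.out⟩)).comp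
      (absGaloisRestrict (Place.Completion (Sum.inr ((primesEquiv (R := 𝓞 ℚ)).symm ⟨p, hp.out⟩) : Place ℚ)) (w.1.adicCompletion (CyclotomicField m ℚ))))),
      (bdRPeriodRingData (valuation_place_lt_one p ((primesEquiv (R := 𝓞 ℚ)).symm ⟨p, hp.out⟩))).CupLogInjective (logCyclotomic p)
      (localRationalTateRep W' p (galRestrictPlace ((primesEquiv (R := 𝓞 ℚ)).symm ⟨p, hp.out⟩))) →
      (∀ z : contOneCocycles (localRationalTateRep W' p (galRestrictPlace ((primesEquiv (R := 𝓞 ℚ)).symm ⟨p, hp.out⟩))).toTopRep,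
      (bdRPeriodRingData (valuation_place_lt_one p ((primesEquiv (R := 𝓞 ℚ)).symm ⟨p, hp.out⟩))).HasDualExp (logCyclotomic p)
      (localRationalTateRep W' p (galRestrictPlace ((primesEquiv (R := 𝓞 ℚ)).symm ⟨p, hp.out⟩))) fun σ => z.1 σ) →
      (bdRPeriodRingData (F := (w.1.adicCompletion (CyclotomicField m ℚ))) (p := p) hL).CupLogInjective (logCyclotomic p) (localRationalTateRep W' p
      ((galRestrictPlace ((primesEquiv (R := 𝓞 ℚ)).symm ⟨p, hp.out⟩)).comp (absGaloisRestrict (Place.Completion (Sum.inr ((primesEquiv (R := 𝓞 ℚ)).symm ⟨p, hp.out⟩) : Place ℚ)) (w.1.adicCompletion (CyclotomicField m ℚ))))) →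
      (∀ z : contOneCocycles (localRationalTateRep W' p
      ((galRestrictPlace ((primesEquiv (R := 𝓞 ℚ)).symm ⟨p, hp.out⟩)).comp (absGaloisRestrict (Place.Completion (Sum.inr ((primesEquiv (R := 𝓞 ℚ)).symm ⟨p, hp.out⟩) : Place ℚ)) (w.1.adicCompletion (CyclotomicField m ℚ))))).toTopRep,
      (bdRPeriodRingData (F := (w.1.adicCompletion (CyclotomicField m ℚ))) (p := p) hL).HasDualExp (logCyclotomic p) (localRationalTateRep W' p
      ((galRestrictPlace ((primesEquiv (R := 𝓞 ℚ)).symm ⟨p, hp.out⟩)).comp (absGaloisRestrict (Place.Completion (Sum.inr ((primesEquiv (R := 𝓞 ℚ)).symm ⟨p, hp.out⟩) : Place ℚ)) (w.1.adicCompletion (CyclotomicField m ℚ)))))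
      fun σ => z.1 σ) → (∀ (η₀ : contOneCocycles (restrictedTateRep W' (Place.Completion (Sum.inr ((primesEquiv (R := 𝓞 ℚ)).symm ⟨p, hp.out⟩) : Place ℚ)) p).toTopRep)
      (ηT : contOneCocycles ((restrictedTateRep W' (Place.Completion (Sum.inr ((primesEquiv (R := 𝓞 ℚ)).symm ⟨p, hp.out⟩) : Place ℚ)) p).restrict
      (absGaloisRestrict (Place.Completion (Sum.inr ((primesEquiv (R := 𝓞 ℚ)).symm ⟨p, hp.out⟩) : Place ℚ)) (w.1.adicCompletion (CyclotomicField m ℚ)))).toTopRep),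
      (∀ σ, ηT.1 σ = η₀.1 (absGaloisRestrict (Place.Completion (Sum.inr ((primesEquiv (R := 𝓞 ℚ)).symm ⟨p, hp.out⟩) : Place ℚ)) (w.1.adicCompletion (CyclotomicField m ℚ)) σ)) →
      expStarCoordTower W' (F₀ := (Place.Completion (Sum.inr ((primesEquiv (R := 𝓞 ℚ)).symm ⟨p, hp.out⟩) : Place ℚ))) hL d ηT =
      algebraMap (Place.Completion (Sum.inr ((primesEquiv (R := 𝓞 ℚ)).symm ⟨p, hp.out⟩) : Place ℚ)) (w.1.adicCompletion (CyclotomicField m ℚ))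
      (expStarCoord W' (valuation_place_lt_one p ((primesEquiv (R := 𝓞 ℚ)).symm ⟨p, hp.out⟩)) d₀ η₀)) →
      ∃ c : (Place.Completion (Sum.inr ((primesEquiv (R := 𝓞 ℚ)).symm ⟨p, hp.out⟩) : Place ℚ)), c ≠ 0 ∧
      (∀ (η₀ : contOneCocycles (restrictedTateRep W' (Place.Completion (Sum.inr ((primesEquiv (R := 𝓞 ℚ)).symm ⟨p, hp.out⟩) : Place ℚ)) p).toTopRep)
      (P : (W'.baseChange (Place.Completion (Sum.inr ((primesEquiv (R := 𝓞 ℚ)).symm ⟨p, hp.out⟩) : Place ℚ))).toAffine.Point),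
      ((tatePairingPoint W' (Place.Completion (Sum.inr ((primesEquiv (R := 𝓞 ℚ)).symm ⟨p, hp.out⟩) : Place ℚ)) p e hμ hadd₁ hadd₂ hgal hcompat (oneCocycleClass _ η₀) P : ℤ_[p]) : ℚ_[p]) =
      Algebra.trace ℚ_[p] (Place.Completion (Sum.inr ((primesEquiv (R := 𝓞 ℚ)).symm ⟨p, hp.out⟩) : Place ℚ))
      (c * expStarCoord W' (valuation_place_lt_one p ((primesEquiv (R := 𝓞 ℚ)).symm ⟨p, hp.out⟩)) d₀ η₀ *
      padicLogPointFiniteExt wv (W'.baseChange (Place.Completion (Sum.inr ((primesEquiv (R := 𝓞 ℚ)).symm ⟨p, hp.out⟩) : Place ℚ))) p P)) ∧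
      (∀ (ηT : contOneCocycles ((restrictedTateRep W' (Place.Completion (Sum.inr ((primesEquiv (R := 𝓞 ℚ)).symm ⟨p, hp.out⟩) : Place ℚ)) p).restrict
      (absGaloisRestrict (Place.Completion (Sum.inr ((primesEquiv (R := 𝓞 ℚ)).symm ⟨p, hp.out⟩) : Place ℚ)) (w.1.adicCompletion (CyclotomicField m ℚ)))).toTopRep)
      (P : (W'.baseChange (w.1.adicCompletion (CyclotomicField m ℚ))).toAffine.Point),
      ((tatePairingPointTower W' (Place.Completion (Sum.inr ((primesEquiv (R := 𝓞 ℚ)).symm ⟨p, hp.out⟩) : Place ℚ)) e hμ hadd₁ hadd₂ hgal hcompat (oneCocycleClass _ ηT) P : ℤ_[p]) : ℚ_[p]) =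
      Algebra.trace ℚ_[p] (w.1.adicCompletion (CyclotomicField m ℚ))
      (algebraMap (Place.Completion (Sum.inr ((primesEquiv (R := 𝓞 ℚ)).symm ⟨p, hp.out⟩) : Place ℚ)) (w.1.adicCompletion (CyclotomicField m ℚ)) c * expStarCoordTower W' (F₀ := (Place.Completion (Sum.inr ((primesEquiv (R := 𝓞 ℚ)).symm ⟨p, hp.out⟩) : Place ℚ))) hL d ηT *
      padicLogPointFiniteExt ν (W'.baseChange (w.1.adicCompletion (CyclotomicField m ℚ))) p P)))
    (hP1 : exists_member_sl2ZetaElement_neron_values_bar) :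
    Summit.BirchSwinnertonDyer.BirchSwinnertonDyer.Theses.EdixhovenFibreFiveSeven.StarredOptimalManinUnitFiveSeven := by
  intro W _ _ p _ _ D hp57 hadd hirr hIstar h4 hopt
  by_cases hord : (p = 5 ↔ padicValInt p W.minimalDiscriminantInt = 9)
  · exact starredOptimalManinUnit_ordinaryCells_of_recTowerAt_of_sl2NeronValuesBar hRECord hP1 W p D rfl hp57 hadd hirr hIstar
      h4 hord hopt
  · exact starredOptimalManinUnit_supersingularCells_of_recTowerAt_of_sl2NeronValuesBar hRECss hP1 W p D rfl hp57 hadd hirr hIstar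
      h4 hord hopt

end Cells

end Summit.BirchSwinnertonDyer.BirchSwinnertonDyer.Theorems.StarredOptimalManinUnitFiveSevenCellsOfRecTowerAt

end
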